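import Literature.NumberTheory.EllipticCurves.Curve24A1Descent
import HarnessLib

/-!
# The curve `15A1 = X₀(15)` has rank `0`: the complete `2`-descent over `ℚ`, carried out

Cremona's curve `15A1 : y² + xy + y = x³ + x² - 10x - 10` (`[a₁, a₂, a₃, a₄, a₆] =
[1, 1, 1, -10, -10]`, conductor `15`, `Δ = 3⁴·5⁴ = 50625`) is the modular curve `X₀(15)`; Cremona,
*Algorithms for Modular Elliptic Curves*, Table 1, `N = 15`, curve `A1`, lists `r = 0`, `|T| = 8`
(`E(ℚ) ≅ ℤ/2ℤ × ℤ/4ℤ`). This file PROVES the first half of that entry, **`r = 0`**, in the form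

* `Literature.NumberTheory.EllipticCurves.Curve15A1.finite_point : Finite (15A1)(ℚ)`,

by the complete `2`-descent of Silverman, *AEC*, Prop. X.1.4 / Example X.1.5, exactly as for
`24A1` in the sibling `Curve24A1Descent.lean` (whose arithmetic lemmas are reused), using only
proved material of the tree: the `2`-descent homomorphism `δ` with kernel `2E(ℚ)`
(`TwoDescent.lean`, which works with a general Weierstrass equation: the rational `2`-torsion of
`15A1` is `(2y + x + 1)² = (x + 1)(4x + 13)(x - 3)`, i.e. `SplitTwoTorsion (-1) 3 (-13/4)`), the
Mordell–Weil theorem (`WeierstrassCurve.module_finite_point_holds`) and the counting lemma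
`2^(r+2) ≤ #δ(E(ℚ))` (`pow_finrank_add_two_le_natCard_range`, `TwoDescentRankBounds.lean`).

## The descent (all proved here), in the coordinates `X = 4x`, `Y = 4(2y + x + 1)`

On `15A1`, `Y² = (X + 4)(X + 13)(X - 12)` (the curve `[0, 5, 0, -152, -624]`, `2`-torsion
abscissae `-4, -13, 12` with differences `9, 16, 25`). For a rational solution with `Y ≠ 0`:
1. `ord_p(X + 4)` is even for `p ∉ {2, 3}`, `ord_p(X - 12)` is even for `p ∉ {2, 5}`, and
   `ord₂(X + 13)` is even (`Curve24A1.even_padicValRat_sub`); hence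
   `|X + 4| ∈ {1, 2, 3, 6}·u²` (`exists_abs_eq_sq_or₂`).
2. **The local computations.** `X + 4 = c u²` with `c ∈ {±2, ±3, ±6}` is impossible: with
   `X + 13 = cu² + 9`, `X - 12 = cu² - 16` the point gives a rational point `(u, W)`,
   `W = Y/(ku)` (`k = 2, 3, 6`), of the quartic `W² = (αu² + β)(γu² + δ)` listed below, and each
   of these six quartics has no rational point by a congruence: writing `u = m/d` in lowest terms,
   `(αm² + βd²)(γm² + δd²)` is an integer square, which is refuted modulo `16` (for `c = ±2`:
   `(±2m² + 9d²)(m² ∓ 8d²)`, a `2`-adic obstruction) or modulo `9` (for `c = ±3`: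
   `(±m² + 3d²)(3m² ∓ 16d²)`; for `c = ±6`: `(±2m² + 3d²)(3m² ∓ 8d²)`; `3`-adic obstructions)
   unless `m, d` are both divisible by `2`, resp. `3` (`not_sq_of_quartic`, the finite checks by
   `decide`). So `X + 4 = ±u²`.
3. Then `ord₂(X - 12) ≡ ord₂(X + 4) + ord₂(X + 13) ≡ 0`, so `|X - 12| ∈ {1, 5}·w²`
   (`Curve24A1.exists_abs_eq_sq_or`), and `X - 12` has the sign of `X + 4` (`Y² > 0`):
   `(X + 4, X - 12) ∈ {(u², w²), (u², 5w²), (-u², -w²), (-u², -5w²)}` (`exists_sq_of_sq_eq`).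
4. So the `2`-descent pair `(x + 1, x - 3) mod ℚˣ²` of every rational point lies in
   `{(1, 1), (1, 5), (-1, -1), (-1, -5)}` (`descentPair_mem`) — the classes of `O, (3, -2)`, of
   `(8, 18), (8, -27)`, of `(-1, 0), (-13/4, 9/8)`, of `(-2, 3), (-2, -2)` — a set of
   `4 = #E(ℚ)[2]` classes, whence `2^(r+2) ≤ 4`, `r = 0`, and `E(ℚ)` is finite by Mordell–Weil
   (`finite_point`, with `T₁ = (-1, 0)` of order `2` and `Q = (8, 18)` of order `4`,
   `2Q = (3, -2)`, as the two torsion points separated by `δ`).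

## References

* [SilvermanAEC2009] J. H. Silverman, *The Arithmetic of Elliptic Curves*, 2nd ed., GTM 106,
  Springer 2009: Prop. X.1.4 (complete `2`-descent), Example X.1.5; Thm. VIII.6.7; X.4.9
  (local obstructions on the homogeneous spaces).
* [CremonaAlgorithms1997] J. E. Cremona, *Algorithms for Modular Elliptic Curves*, 2nd ed., CUP
  1997: Table 1, `N = 15`, curve `A1 = [1, 1, 1, -10, -10]`, `r = 0`, `|T| = 8`; §3.6.

## Design

* Theorems only (no definitions, no new facts, no notation); the curve is written literally
  `⟨1, 1, 1, -10, -10⟩`, as in its consumers. Statements about points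
  avoid the group law or are polymorphic in the `DecidableEq ℚ` instance; inside `finite_point`
  the group law is elaborated against the classical instance (`letI := Classical.decEq ℚ`), the
  one carried by `WeierstrassCurve.mordellWeilRank` and the general-field theorems, exactly as in
  `Curve24A1Descent.lean`.
* Helper lemmas in `namespace Literature.NumberTheory.EllipticCurves.Curve15A1`.
-/

noncomputable section

open WeierstrassCurve WeierstrassCurve.Affine WeierstrassCurve.Affine.Point

namespace Literature.NumberTheory.EllipticCurves

namespace Curve15A1

open Curve24A1

/-! ### Arithmetic of `ℚ`: square classes away from two primes, local insolubility of quartics -/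

/-- **From even valuations away from `q, q'` to a square class in `{1, q, q', qq'}`**: if `r ≠ 0`
and `ord_p(r)` is even for every prime `p ∉ {q, q'}`, then `|r| = u²`, `q u²`, `q' u²` or
`q' q u²` for some rational `u` (the step "`b ∈ ℚ(S, 2)` is represented by `±∏_{p ∈ S} p^{ε_p}`"
of Silverman, *AEC*, Example X.1.5, for `S ⊇ {q, q'}`). [folklore] -/
theorem exists_abs_eq_sq_or₂ {r : ℚ} (hr : r ≠ 0) (q q' : ℕ) [Fact q.Prime] [hq' : Fact q'.Prime]
    (h : ∀ p : ℕ, p.Prime → p ≠ q → p ≠ q' → Even (padicValRat p r)) :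
    ∃ u : ℚ, |r| = u ^ 2 ∨ |r| = q * u ^ 2 ∨ |r| = q' * u ^ 2 ∨ |r| = q' * q * u ^ 2 := by
  by_cases hev : Even (padicValRat q' r)
  · obtain ⟨u, hu⟩ := exists_abs_eq_sq_or hr q fun p hp hpq => by
      by_cases hpq' : p = q'
      · subst hpq'
        exact hev
      · exact h p hp hpq hpq'
    rcases hu with hu | hu
    · exact ⟨u, Or.inl hu⟩
    · exact ⟨u, Or.inr (Or.inl hu)⟩
  · have hq0 : (q' : ℚ) ≠ 0 := Nat.cast_ne_zero.mpr hq'.out.ne_zero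
    obtain ⟨u, hu⟩ := exists_abs_eq_sq_or (div_ne_zero hr hq0) q fun p hp hpq => by
      haveI := Fact.mk hp
      rw [padicValRat.div hr hq0, padicValRat.of_nat]
      by_cases hpq' : p = q'
      · subst hpq'
        rw [padicValNat_self, Nat.cast_one]
        rw [Int.not_even_iff_odd] at hev
        obtain ⟨k, hk⟩ := hev
        exact ⟨k, by omega⟩
      · rw [padicValNat_primes hpq', Nat.cast_zero, sub_zero]
        exact h p hp hpq hpq'
    have habs : |r| = q' * |r / q'| := by
      rw [abs_div, Nat.abs_cast, mul_div_cancel₀ _ hq0]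
    rcases hu with hu | hu
    · exact ⟨u, Or.inr (Or.inr (Or.inl (by rw [habs, hu])))⟩
    · exact ⟨u, Or.inr (Or.inr (Or.inr (by rw [habs, hu]; ring)))⟩

/-- **Local insolubility of a quartic `W² = (αu² + β)(γu² + δ)` by a congruence** (the
elementary form of a `p`-adic obstruction on a homogeneous space of the `2`-descent, Silverman,
*AEC*, X.1.5 / X.4.9): write `u = m/d` in lowest terms; then `(αm² + βd²)(γm² + δd²) = (Wd²)²`
is the square of an integer, so if modulo `N = p·t` every pair `(m, d)` at which this form is a
square modulo `N` has `t·m ≡ t·d ≡ 0`, i.e. `p ∣ m` and `p ∣ d` (hypothesis `H`, with `hS` the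
list of squares modulo `N`; both decidable), this contradicts `gcd(m, d) = 1`. [folklore] -/
theorem not_sq_of_quartic {N : ℕ} [NeZero N] (p t : ℕ) (hp : p.Prime) (hN : p * t = N)
    (S : Finset (ZMod N)) (hS : ∀ z : ZMod N, z ^ 2 ∈ S) {α β γ δ : ℤ}
    (H : ∀ m d : ZMod N, ((α : ZMod N) * m ^ 2 + β * d ^ 2) * (γ * m ^ 2 + δ * d ^ 2) ∈ S →
      (t : ZMod N) * m = 0 ∧ (t : ZMod N) * d = 0)
    {u W : ℚ} (h : W ^ 2 = ((α : ℚ) * u ^ 2 + β) * (γ * u ^ 2 + δ)) : False := by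
  -- clear denominators: `u = m / d` in lowest terms
  set m : ℤ := u.num with hm
  set d : ℕ := u.den with hd
  have hud : u * d = m := Rat.mul_den_eq_num u
  have key : (W * (d : ℚ) ^ 2) ^ 2 =
      (((α * m ^ 2 + β * (d : ℤ) ^ 2) * (γ * m ^ 2 + δ * (d : ℤ) ^ 2) : ℤ) : ℚ) := by
    push_cast
    rw [← hud]
    linear_combination (d : ℚ) ^ 4 * h
  -- an integer which is the square of a rational is the square of an integer
  obtain ⟨z, hz⟩ : IsSquare ((α * m ^ 2 + β * (d : ℤ) ^ 2) * (γ * m ^ 2 + δ * (d : ℤ) ^ 2)) :=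
    Rat.isSquare_intCast_iff.mp ⟨W * (d : ℚ) ^ 2, by rw [← sq, key]⟩
  -- reduce modulo `N`
  have hzN : ((α : ZMod N) * (m : ZMod N) ^ 2 + β * (d : ZMod N) ^ 2) *
      (γ * (m : ZMod N) ^ 2 + δ * (d : ZMod N) ^ 2) = (z : ZMod N) ^ 2 := by
    have := congrArg (Int.cast : ℤ → ZMod N) hz
    push_cast at this
    linear_combination this
  have hQS := hS (z : ZMod N)
  rw [← hzN] at hQS
  obtain ⟨h₁, h₂⟩ := H _ _ hQS
  -- `p ∣ m` and `p ∣ d`, contradicting `gcd(m, d) = 1`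
  have ht0 : (t : ℤ) ≠ 0 := by
    have hN0 : N ≠ 0 := NeZero.ne N
    rw [← hN] at hN0
    exact_mod_cast (Nat.mul_ne_zero_iff.mp hN0).2
  have hdvd : ∀ k : ℤ, (t : ZMod N) * (k : ZMod N) = 0 → (p : ℤ) ∣ k := fun k hk => by
    have hk' : ((t * k : ℤ) : ZMod N) = 0 := by push_cast; exact hk
    obtain ⟨c, hc⟩ := (ZMod.intCast_zmod_eq_zero_iff_dvd _ N).mp hk'
    rw [← hN, Nat.cast_mul] at hc
    exact ⟨c, mul_left_cancel₀ ht0 (by linear_combination hc)⟩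
  have hpm : p ∣ m.natAbs := Int.natCast_dvd.mp (hdvd m h₁)
  have hpd : p ∣ d := Int.natCast_dvd_natCast.mp (hdvd d (by exact_mod_cast h₂))
  exact hp.one_lt.ne' (Nat.eq_one_of_dvd_coprimes u.reduced hpm hpd)

/-- `5` is not the square of a rational number (`ord₅ 5 = 1` is odd). [folklore] -/
theorem five_ne_sq (u : ℚ) : (5 : ℚ) ≠ u ^ 2 := by
  intro h
  haveI : Fact (Nat.Prime 5) := ⟨Nat.prime_five⟩
  have key := congrArg (padicValRat 5) h
  rw [padicValRat.pow, show (5 : ℚ) = ((5 : ℕ) : ℚ) by norm_num, padicValRat.of_nat,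
    padicValNat_self] at key
  omega

/-- **The `2`-descent on `15A1`, arithmetic core** (Silverman, *AEC*, Example X.1.5 carried out
for `Y² = (X + 4)(X + 13)(X - 12)`, `S = {2, 3, 5, ∞}`): for rationals with `Y ≠ 0` there are
non-zero rationals `u, w` with
`(X + 4, X - 12) ∈ {(u², w²), (u², 5w²), (-u², -w²), (-u², -5w²)}`. Proof: steps 1–3 of the
module docstring — valuations away from `{2, 3}`, `{2, 5}` (`even_padicValRat_sub`), the six
local computations excluding `X + 4 = ±2u², ±3u², ±6u²` (`not_sq_of_quartic` modulo `16`, `9`,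
`9`), the parity of `ord₂(X - 12)` from `ord₂(X + 4) + ord₂(X + 13) + ord₂(X - 12) = 2 ord₂ Y`,
and signs. [cite: SilvermanAEC2009, Example X.1.5 (method)] -/
theorem exists_sq_of_sq_eq {X Y : ℚ} (hY : Y ≠ 0) (h : Y ^ 2 = (X + 4) * (X + 13) * (X - 12)) :
    ∃ u w : ℚ, u ≠ 0 ∧ w ≠ 0 ∧
      ((X + 4 = u ^ 2 ∧ (X - 12 = w ^ 2 ∨ X - 12 = 5 * w ^ 2)) ∨
        (X + 4 = -u ^ 2 ∧ (X - 12 = -w ^ 2 ∨ X - 12 = -5 * w ^ 2))) := by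
  have h₀ : (X + 4) * (X + 13) * (X - 12) ≠ 0 := h ▸ pow_ne_zero 2 hY
  have hx₁ : X + 4 ≠ 0 := fun h0 => h₀ (by rw [h0, zero_mul, zero_mul])
  have hx₂ : X + 13 ≠ 0 := fun h0 => h₀ (by rw [h0, mul_zero, zero_mul])
  have hx₃ : X - 12 ≠ 0 := fun h0 => h₀ (by rw [h0, mul_zero])
  haveI : Fact (Nat.Prime 5) := ⟨Nat.prime_five⟩
  -- parities of valuations at the primes not dividing the differences `9, 16, 25`
  have P₁ : ∀ p : ℕ, p.Prime → p ≠ 2 → p ≠ 3 → Even (padicValRat p (X + 4)) := by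
    intro p hp hp2 hp3
    haveI := Fact.mk hp
    have key := even_padicValRat_sub p (e₁ := -4) (e₂ := -13) (e₃ := 12) (x := X)
      (by norm_num) (by norm_num) ?_ ?_ hY (by rw [h]; ring)
    · rwa [sub_neg_eq_add] at key
    · rw [show (-4 : ℚ) - (-13) = ((3 : ℕ) : ℚ) ^ 2 by norm_num, padicValRat.pow,
        padicValRat.of_nat, padicValNat_primes hp3, Nat.cast_zero, mul_zero]
    · rw [show (-4 : ℚ) - 12 = -(((2 : ℕ) : ℚ) ^ 4) by norm_num, padicValRat.neg,
        padicValRat.pow, padicValRat.of_nat, padicValNat_primes hp2, Nat.cast_zero, mul_zero]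
  have P₂ : Even (padicValRat 2 (X + 13)) := by
    have key := even_padicValRat_sub 2 (e₁ := -13) (e₂ := -4) (e₃ := 12) (x := X)
      (by norm_num) (by norm_num) ?_ ?_ hY (by rw [h]; ring)
    · rwa [sub_neg_eq_add] at key
    · rw [show (-13 : ℚ) - (-4) = -(((3 : ℕ) : ℚ) ^ 2) by norm_num, padicValRat.neg,
        padicValRat.pow, padicValRat.of_nat, padicValNat_primes (by decide), Nat.cast_zero,
        mul_zero]
    · rw [show (-13 : ℚ) - 12 = -(((5 : ℕ) : ℚ) ^ 2) by norm_num, padicValRat.neg,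
        padicValRat.pow, padicValRat.of_nat, padicValNat_primes (by decide), Nat.cast_zero,
        mul_zero]
  have P₃ : ∀ p : ℕ, p.Prime → p ≠ 2 → p ≠ 5 → Even (padicValRat p (X - 12)) := by
    intro p hp hp2 hp5
    haveI := Fact.mk hp
    refine even_padicValRat_sub p (e₁ := 12) (e₂ := -4) (e₃ := -13) (x := X)
      (by norm_num) (by norm_num) ?_ ?_ hY (by rw [h]; ring)
    · rw [show (12 : ℚ) - (-4) = ((2 : ℕ) : ℚ) ^ 4 by norm_num, padicValRat.pow,
        padicValRat.of_nat, padicValNat_primes hp2, Nat.cast_zero, mul_zero]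
    · rw [show (12 : ℚ) - (-13) = ((5 : ℕ) : ℚ) ^ 2 by norm_num, padicValRat.pow,
        padicValRat.of_nat, padicValNat_primes hp5, Nat.cast_zero, mul_zero]
  -- the square class of `X + 4` away from `{2, 3}`
  obtain ⟨u, hu⟩ := exists_abs_eq_sq_or₂ hx₁ 2 3 P₁
  push_cast at hu
  have hu0 : u ≠ 0 := by
    rintro rfl
    have : |X + 4| = 0 := by rcases hu with hu | hu | hu | hu <;> rw [hu] <;> ring
    exact hx₁ (abs_eq_zero.mp this)
  have h' : Y ^ 2 = (X + 4) * ((X + 4) + 9) * ((X + 4) - 16) := by rw [h]; ring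
  -- the squares modulo `16` and `9`, and the six local computations
  have S₁₆ : ∀ z : ZMod 16, z ^ 2 ∈ ({0, 1, 4, 9} : Finset (ZMod 16)) := by decide
  have S₉ : ∀ z : ZMod 9, z ^ 2 ∈ ({0, 1, 4, 7} : Finset (ZMod 9)) := by decide
  have main : X + 4 = u ^ 2 ∨ X + 4 = -u ^ 2 := by
    rcases lt_or_gt_of_ne hx₁ with hneg | hpos
    · rw [abs_of_neg hneg] at hu
      rcases hu with hu | hu | hu | hu
      · exact Or.inr (by linarith)
      · -- `X + 4 = -2u²`: `(Y/2u)² = (-2u² + 9)(u² + 8)`, insoluble modulo `16`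
        exfalso
        rw [show X + 4 = -2 * u ^ 2 by linarith] at h'
        refine not_sq_of_quartic 2 8 Nat.prime_two rfl _ S₁₆ (α := -2) (β := 9) (γ := 1) (δ := 8)
          (by decide) (u := u) (W := Y / (2 * u)) ?_
        push_cast
        field_simp
        linear_combination h'
      · -- `X + 4 = -3u²`: `(Y/3u)² = (-u² + 3)(3u² + 16)`, insoluble modulo `9`
        exfalso
        rw [show X + 4 = -3 * u ^ 2 by linarith] at h'
        refine not_sq_of_quartic 3 3 Nat.prime_three rfl _ S₉ (α := -1) (β := 3) (γ := 3)
          (δ := 16) (by decide) (u := u) (W := Y / (3 * u)) ?_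
        push_cast
        field_simp
        linear_combination h'
      · -- `X + 4 = -6u²`: `(Y/6u)² = (-2u² + 3)(3u² + 8)`, insoluble modulo `9`
        exfalso
        rw [show X + 4 = -6 * u ^ 2 by linarith] at h'
        refine not_sq_of_quartic 3 3 Nat.prime_three rfl _ S₉ (α := -2) (β := 3) (γ := 3)
          (δ := 8) (by decide) (u := u) (W := Y / (6 * u)) ?_
        push_cast
        field_simp
        linear_combination h'
    · rw [abs_of_pos hpos] at hu
      rcases hu with hu | hu | hu | hu
      · exact Or.inl hu
      · -- `X + 4 = 2u²`: `(Y/2u)² = (2u² + 9)(u² - 8)`, insoluble modulo `16`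
        exfalso
        rw [hu] at h'
        refine not_sq_of_quartic 2 8 Nat.prime_two rfl _ S₁₆ (α := 2) (β := 9) (γ := 1) (δ := -8)
          (by decide) (u := u) (W := Y / (2 * u)) ?_
        push_cast
        field_simp
        linear_combination h'
      · -- `X + 4 = 3u²`: `(Y/3u)² = (u² + 3)(3u² - 16)`, insoluble modulo `9`
        exfalso
        rw [hu] at h'
        refine not_sq_of_quartic 3 3 Nat.prime_three rfl _ S₉ (α := 1) (β := 3) (γ := 3)
          (δ := -16) (by decide) (u := u) (W := Y / (3 * u)) ?_
        push_cast
        field_simp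
        linear_combination h'
      · -- `X + 4 = 6u²`: `(Y/6u)² = (2u² + 3)(3u² - 8)`, insoluble modulo `9`
        exfalso
        rw [hu] at h'
        refine not_sq_of_quartic 3 3 Nat.prime_three rfl _ S₉ (α := 2) (β := 3) (γ := 3)
          (δ := -8) (by decide) (u := u) (W := Y / (6 * u)) ?_
        push_cast
        field_simp
        linear_combination h'
  -- `ord₂(X - 12)` is even, hence `ord_p(X - 12)` is even for every `p ≠ 5`
  have P₃' : ∀ p : ℕ, p.Prime → p ≠ 5 → Even (padicValRat p (X - 12)) := by
    intro p hp hp5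
    by_cases hp2 : p = 2
    · subst hp2
      have hsum : 2 * padicValRat 2 Y =
          padicValRat 2 (X + 4) + padicValRat 2 (X + 13) + padicValRat 2 (X - 12) := by
        have key := congrArg (padicValRat 2) h
        rw [padicValRat.pow, padicValRat.mul (mul_ne_zero hx₁ hx₂) hx₃, padicValRat.mul hx₁ hx₂]
          at key
        exact_mod_cast key
      have h4 : Even (padicValRat 2 (X + 4)) := by
        rcases main with h4 | h4
        · rw [h4, padicValRat.pow]
          exact even_two_mul _
        · rw [h4, padicValRat.neg, padicValRat.pow]
          exact even_two_mul _
      obtain ⟨a, ha⟩ := h4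
      obtain ⟨b, hb⟩ := P₂
      exact ⟨padicValRat 2 Y - a - b, by omega⟩
    · exact P₃ p hp hp2 hp5
  obtain ⟨w, hw⟩ := exists_abs_eq_sq_or hx₃ 5 P₃'
  push_cast at hw
  have hw0 : w ≠ 0 := by
    rintro rfl
    have : |X - 12| = 0 := by rcases hw with hw | hw <;> rw [hw] <;> ring
    exact hx₃ (abs_eq_zero.mp this)
  -- signs: `X - 12` has the sign of `X + 4`
  have hprod : 0 < (X + 4) * (X + 13) * (X - 12) := by rw [← h]; positivity
  refine ⟨u, w, hu0, hw0, ?_⟩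
  rcases main with h4 | h4
  · have hpos : 0 < X + 4 := by rw [h4]; positivity
    have hpos' : 0 < X - 12 := by
      by_contra hle
      push Not at hle
      nlinarith [mul_pos hpos (show 0 < X + 13 by linarith)]
    rw [abs_of_pos hpos'] at hw
    exact Or.inl ⟨h4, hw⟩
  · have hneg : X + 4 < 0 := by
      rw [h4, neg_lt_zero]
      positivity
    have hneg' : X - 12 < 0 := by linarith
    rw [abs_of_neg hneg'] at hw
    refine Or.inr ⟨h4, ?_⟩
    rcases hw with hw | hw
    · exact Or.inl (by linarith)
    · exact Or.inr (by linarith)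

/-! ### The curve `15A1`: equation, rational `2`-torsion `-1, 3, -13/4`, the `2`-descent -/

/-- A solution of `y² + xy + y = x³ + x² - 10x - 10` is an affine point of `15A1` (the
affine equation, in the direction used to exhibit the torsion points).
[cite: CremonaAlgorithms1997, Table 1, N = 15, curve A1] -/
theorem equation_of_eq {x y : ℚ} (h : y ^ 2 + x * y + y = x ^ 3 + x ^ 2 - 10 * x - 10) :
    (⟨1, 1, 1, -10, -10⟩ : WeierstrassCurve ℚ).toAffine.Equation x y := by
  rw [Affine.equation_iff]
  linear_combination h

/-- `15A1` has rational `2`-torsion with `e₁ = -1, e₂ = 3, e₃ = -13/4`: the `2`-division cubic is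
`4x³ + b₂x² + 2b₄x + b₆ = 4x³ + 5x² - 38x - 39 = (x + 1)(x - 3)(4x + 13)` (`b₂ = 5`,
`b₄ = -19`, `b₆ = -39`), the hypothesis `SplitTwoTorsion` of the tree's complete `2`-descent
(Cremona, Table 1, `15A1`: `|T| = 8`, so `E[2] ⊆ E(ℚ)`).
[cite: CremonaAlgorithms1997, Table 1, N = 15, curve A1] -/
theorem splitTwoTorsion :
    (⟨1, 1, 1, -10, -10⟩ : WeierstrassCurve ℚ).toAffine.SplitTwoTorsion (-1) 3 (-13 / 4) := by
  refine ⟨?_, ?_, ?_⟩ <;> norm_num [b₂, b₄, b₆]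

/-- On `15A1`, in the coordinates `X = 4x`, `Y = 4(2y + x + 1)`:
`Y² = (X + 4)(X + 13)(X - 12)`. [cite: CremonaAlgorithms1997, Table 1, N = 15, curve A1] -/
theorem sq_eq_of_equation {x y : ℚ}
    (h : (⟨1, 1, 1, -10, -10⟩ : WeierstrassCurve ℚ).toAffine.Equation x y) :
    (4 * (2 * y + x + 1)) ^ 2 = (4 * x + 4) * (4 * x + 13) * (4 * x - 12) := by
  rw [Affine.equation_iff] at h
  linear_combination 64 * h

/-- An affine point of `15A1` with `2y + x + 1 = 0` is one of the three `2`-torsion points,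
`x ∈ {-1, 3, -13/4}`. [cite: CremonaAlgorithms1997, Table 1, N = 15, curve A1] -/
theorem x_eq_of_eq_zero {x y : ℚ}
    (h : (⟨1, 1, 1, -10, -10⟩ : WeierstrassCurve ℚ).toAffine.Equation x y)
    (hy : 2 * y + x + 1 = 0) :
    x = -1 ∨ x = 3 ∨ x = -13 / 4 := by
  have hE := sq_eq_of_equation h
  rw [hy, mul_zero, zero_pow two_ne_zero, zero_eq_mul, mul_eq_zero] at hE
  rcases hE with (hE | hE) | hE
  · exact Or.inl (by linarith)
  · exact Or.inr (Or.inr (by linarith))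
  · exact Or.inr (Or.inl (by linarith))

/-- **The image of the complete `2`-descent on `15A1`** (Silverman, *AEC*, Prop. X.1.4 and
Example X.1.5): for every rational point `P`, the pair of descent components
`(δ₁(P), δ₂(P)) = (x + 1, x - 3) ∈ ℚˣ/ℚˣ² × ℚˣ/ℚˣ²` (with the conventions at `O, T₁, T₂`) is one
of the four classes `(1, 1), (1, 5), (-1, -1), (-1, -5)`. Proof: direct evaluation at `O` and at
the `2`-torsion points, and `exists_sq_of_sq_eq` (with `X = 4x`) at the other points. Polymorphic
in the `DecidableEq ℚ` argument of the tree's `twoDescentComponent`.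
[cite: SilvermanAEC2009, Prop. X.1.4 and Example X.1.5] -/
theorem descentPair_mem [DecidableEq ℚ]
    (P : (⟨1, 1, 1, -10, -10⟩ : WeierstrassCurve ℚ).toAffine.Point) :
    (twoDescentComponent (⟨1, 1, 1, -10, -10⟩ : WeierstrassCurve ℚ).toAffine (-1) 3 (-13 / 4) P,
      twoDescentComponent (⟨1, 1, 1, -10, -10⟩ : WeierstrassCurve ℚ).toAffine 3 (-1) (-13 / 4) P) ∈
      ({(1, 1), (1, sqClass 5), (sqClass (-1), sqClass (-1)), (sqClass (-1), sqClass (-5))} :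
        Set (SqUnits ℚ × SqUnits ℚ)) := by
  simp only [Set.mem_insert_iff, Set.mem_singleton_iff, Prod.mk.injEq]
  rcases P with _ | ⟨x, y, hP⟩
  · exact Or.inl ⟨rfl, rfl⟩
  · by_cases hx1 : x = -1
    · subst hx1
      refine Or.inr (Or.inr (Or.inl ⟨?_, ?_⟩))
      · rw [twoDescentComponent_some_of_eq hP rfl,
          show ((-1 : ℚ) - 3) * (-1 - (-13 / 4)) = -1 * 3 ^ 2 by norm_num,
          sqClass_mul_sq (by norm_num) (by norm_num)]
      · rw [twoDescentComponent_some_of_ne hP (by norm_num),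
          show (-1 : ℚ) - 3 = -1 * 2 ^ 2 by norm_num, sqClass_mul_sq (by norm_num) (by norm_num)]
    by_cases hx2 : x = 3
    · subst hx2
      refine Or.inl ⟨?_, ?_⟩
      · rw [twoDescentComponent_some_of_ne hP (by norm_num),
          show (3 : ℚ) - (-1) = 2 ^ 2 by norm_num, sqClass_sq]
      · rw [twoDescentComponent_some_of_eq hP rfl,
          show ((3 : ℚ) - (-1)) * (3 - (-13 / 4)) = 5 ^ 2 by norm_num, sqClass_sq]
    by_cases hx3 : x = -13 / 4
    · subst hx3
      refine Or.inr (Or.inr (Or.inl ⟨?_, ?_⟩))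
      · rw [twoDescentComponent_some_of_ne hP (by norm_num),
          show (-13 / 4 : ℚ) - (-1) = -1 * (3 / 2) ^ 2 by norm_num,
          sqClass_mul_sq (by norm_num) (by norm_num)]
      · rw [twoDescentComponent_some_of_ne hP (by norm_num),
          show (-13 / 4 : ℚ) - 3 = -1 * (5 / 2) ^ 2 by norm_num,
          sqClass_mul_sq (by norm_num) (by norm_num)]
    have hy : 4 * (2 * y + x + 1) ≠ 0 := fun hy => by
      rcases x_eq_of_eq_zero hP.1 (by linarith) with h | h | h
      · exact hx1 h
      · exact hx2 h
      · exact hx3 h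
    obtain ⟨u, w, hu, hw, hcases⟩ := exists_sq_of_sq_eq hy (sq_eq_of_equation hP.1)
    have hu2 : u / 2 ≠ 0 := div_ne_zero hu two_ne_zero
    have hw2 : w / 2 ≠ 0 := div_ne_zero hw two_ne_zero
    rw [twoDescentComponent_some_of_ne hP hx1, twoDescentComponent_some_of_ne hP hx2]
    rcases hcases with ⟨h1, h2 | h2⟩ | ⟨h1, h2 | h2⟩
    · refine Or.inl ⟨?_, ?_⟩
      · rw [show x - (-1) = (u / 2) ^ 2 by linear_combination h1 / 4, sqClass_sq]
      · rw [show x - 3 = (w / 2) ^ 2 by linear_combination h2 / 4, sqClass_sq]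
    · refine Or.inr (Or.inl ⟨?_, ?_⟩)
      · rw [show x - (-1) = (u / 2) ^ 2 by linear_combination h1 / 4, sqClass_sq]
      · rw [show x - 3 = 5 * (w / 2) ^ 2 by linear_combination h2 / 4,
          sqClass_mul_sq (by norm_num) hw2]
    · refine Or.inr (Or.inr (Or.inl ⟨?_, ?_⟩))
      · rw [show x - (-1) = -1 * (u / 2) ^ 2 by linear_combination h1 / 4,
          sqClass_mul_sq (by norm_num) hu2]
      · rw [show x - 3 = -1 * (w / 2) ^ 2 by linear_combination h2 / 4,
          sqClass_mul_sq (by norm_num) hw2]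
    · refine Or.inr (Or.inr (Or.inr ⟨?_, ?_⟩))
      · rw [show x - (-1) = -1 * (u / 2) ^ 2 by linear_combination h1 / 4,
          sqClass_mul_sq (by norm_num) hu2]
      · rw [show x - 3 = -5 * (w / 2) ^ 2 by linear_combination h2 / 4,
          sqClass_mul_sq (by norm_num) hw2]

/-! ### Rank zero: `E(ℚ)` is finite -/

/-- **`2 · (8, 18) = (3, -2)` on `15A1`** (chord-and-tangent: tangent slope `4` at `(8, 18)`),
so that `(8, 18)` is a point of order `4` (Cremona, Table 1, `15A1`: `T ≅ ℤ/2ℤ × ℤ/4ℤ`).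
Polymorphic in the `DecidableEq ℚ` instance behind Mathlib's group law.
[cite: CremonaAlgorithms1997, Table 1, N = 15, curve A1] -/
theorem add_self_eight [DecidableEq ℚ]
    (hQ : (⟨1, 1, 1, -10, -10⟩ : WeierstrassCurve ℚ).toAffine.Nonsingular 8 18)
    (hT : (⟨1, 1, 1, -10, -10⟩ : WeierstrassCurve ℚ).toAffine.Nonsingular 3 (-2)) :
    Point.some 8 18 hQ + Point.some 8 18 hQ = Point.some 3 (-2) hT := by
  have hy : (18 : ℚ) ≠ (⟨1, 1, 1, -10, -10⟩ : WeierstrassCurve ℚ).toAffine.negY 8 18 := by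
    norm_num [negY]
  rw [add_self_of_Y_ne hy]
  congr 1
  · rw [slope_of_Y_ne rfl hy]
    norm_num [addX, negY]
  · rw [slope_of_Y_ne rfl hy]
    norm_num [addY, negAddY, addX, negY]

/-- **`15A1` has Mordell–Weil rank `0`: `E(ℚ)` is finite** (Cremona, *Algorithms for Modular
Elliptic Curves*, Table 1, `N = 15`, curve `A1`: `r = 0`), proved by the complete `2`-descent
(Silverman, *AEC*, Prop. X.1.4, Example X.1.5): the `2`-descent map `δ` (tree `twoDescentMap`,
kernel `2E(ℚ)`) takes at most the `4` values of `descentPair_mem`, while by the counting lemma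
`pow_finrank_add_two_le_natCard_range` (with the torsion points `T₁ = (-1, 0)` and `Q = (8, 18)`,
`2Q = (3, -2)`, which `δ` separates: `δ(T₁) = (-9, -4)`, `δ(Q) = (9, 5)`, `δ(T₁ + Q) = (-81, -20)`,
as `-9, 5, -81` are not rational squares) it takes at least `2^(r + 2)` values,
`r = rank_ℤ E(ℚ)` (Mordell–Weil, tree `module_finite_point_holds`); so `r = 0` and `E(ℚ)` is
finite (`finite_point_of_mordellWeilRank_eq_zero`).
[cite: CremonaAlgorithms1997, Table 1, N = 15, curve A1 (r = 0)] -/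
theorem finite_point : Finite (⟨1, 1, 1, -10, -10⟩ : WeierstrassCurve ℚ).toAffine.Point := by
  letI := Classical.decEq ℚ
  -- `Δ = 50625 = 3⁴·5⁴ ≠ 0`
  haveI : (⟨1, 1, 1, -10, -10⟩ : WeierstrassCurve ℚ).IsElliptic :=
    ⟨by
      rw [show (⟨1, 1, 1, -10, -10⟩ : WeierstrassCurve ℚ).Δ = 50625 by
        norm_num [WeierstrassCurve.Δ, b₂, b₄, b₆, b₈]]
      norm_num⟩
  haveI : Module.Finite ℤ (⟨1, 1, 1, -10, -10⟩ : WeierstrassCurve ℚ).toAffine.Point :=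
    WeierstrassCurve.module_finite_point_holds (W := ⟨1, 1, 1, -10, -10⟩)
  have h := splitTwoTorsion
  set ψ := twoDescentMap h with hψ
  -- the torsion points `T₁ = (-1, 0)`, `Q = (8, 18)`, `T₂ = (3, -2) = 2Q`
  have hns : ∀ {a b : ℚ}, (⟨1, 1, 1, -10, -10⟩ : WeierstrassCurve ℚ).toAffine.Equation a b →
      (⟨1, 1, 1, -10, -10⟩ : WeierstrassCurve ℚ).toAffine.Nonsingular a b :=
    fun hab => equation_iff_nonsingular.mp hab
  have hT₁ := hns (equation_of_eq (x := -1) (y := 0) (by norm_num))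
  have hT₂ := hns (equation_of_eq (x := 3) (y := -2) (by norm_num))
  have hQ := hns (equation_of_eq (x := 8) (y := 18) (by norm_num))
  set T₁ := Point.some (-1) 0 hT₁ with hT₁def
  set Q := Point.some 8 18 hQ with hQdef
  have h81 : (8 : ℚ) ≠ -1 := by norm_num
  have h83 : (8 : ℚ) ≠ 3 := by norm_num
  have h13 : (-1 : ℚ) ≠ 3 := by norm_num
  -- negative numbers and `5` are not squares
  have hnegsq : ∀ {c : ℚ}, c < 0 → sqClass c ≠ 1 := fun hc h1 => by
    obtain ⟨v, hv⟩ := (sqClass_eq_one_iff hc.ne).mp h1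
    nlinarith [sq_nonneg v]
  have h5 : sqClass (5 : ℚ) ≠ 1 := fun h1 => by
    obtain ⟨v, hv⟩ := (sqClass_eq_one_iff (by norm_num)).mp h1
    exact five_ne_sq v hv
  -- values of `ψ`
  have hψT₁ : ψ T₁ = Additive.ofMul (sqClass ((-1 - 3) * (-1 - (-13 / 4))), sqClass (-1 - 3)) := by
    rw [hψ, twoDescentMap_apply, twoDescentComponent_some_of_eq hT₁ rfl,
      twoDescentComponent_some_of_ne hT₁ h13]
  have hψQ : ψ Q = Additive.ofMul (sqClass (8 - (-1)), sqClass (8 - 3)) := by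
    rw [hψ, twoDescentMap_apply, twoDescentComponent_some_of_ne hQ h81,
      twoDescentComponent_some_of_ne hQ h83]
  have h₁ : ψ T₁ ≠ 0 := by
    rw [hψT₁, Ne, ofMul_eq_zero, Prod.mk_eq_one, not_and_or]
    exact Or.inr (hnegsq (by norm_num))
  have h₂ : ψ Q ≠ 0 := by
    rw [hψQ, Ne, ofMul_eq_zero, Prod.mk_eq_one, not_and_or]
    refine Or.inr ?_
    norm_num
    exact h5
  have h₃ : ψ (T₁ + Q) ≠ 0 := by
    rw [map_add, hψT₁, hψQ, ← ofMul_mul, Prod.mk_mul_mk, Ne, ofMul_eq_zero, Prod.mk_eq_one,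
      not_and_or]
    refine Or.inl ?_
    rw [← sqClass_mul (by norm_num) (by norm_num)]
    exact hnegsq (by norm_num)
  have h₁₂ : ψ T₁ ≠ ψ Q := by
    rw [hψT₁, hψQ, Ne, Additive.ofMul.apply_eq_iff_eq, Prod.mk.injEq, not_and_or]
    refine Or.inl fun heq => hnegsq (c := ((-1 : ℚ) - 3) * (-1 - (-13 / 4)) * (8 - (-1)))
      (by norm_num) ?_
    rw [sqClass_mul (by norm_num) (by norm_num), heq, SqUnits.mul_self]
  -- the kernel of `ψ` is `2E(ℚ)`
  have hker : ∀ a, ψ a = 0 → ∃ b, a = 2 • b := fun a ha => by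
    have ha' : a ∈ ψ.ker := ha
    rw [hψ, ker_twoDescentMap h] at ha'
    obtain ⟨b, hb⟩ := ha'
    exact ⟨b, hb.symm⟩
  -- finite order of `T₁` and `Q`
  have hfin₁ : IsOfFinAddOrder T₁ := by
    refine isOfFinAddOrder_iff_nsmul_eq_zero.mpr ⟨2, two_pos, ?_⟩
    rw [two_nsmul, hT₁def]
    exact add_self_of_Y_eq (by norm_num [negY])
  have hfin₂ : IsOfFinAddOrder Q := by
    refine isOfFinAddOrder_iff_nsmul_eq_zero.mpr ⟨4, by norm_num, ?_⟩
    rw [show 4 • Q = 2 • (Q + Q) by rw [← two_nsmul, ← mul_nsmul'], hQdef,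
      add_self_eight hQ hT₂, two_nsmul]
    exact add_self_of_Y_eq (by norm_num [negY])
  -- the range of `ψ` has at most `4` elements
  set S : Set (SqUnits ℚ × SqUnits ℚ) := {(1, 1), (1, sqClass 5), (sqClass (-1), sqClass (-1)),
    (sqClass (-1), sqClass (-5))} with hS
  have hSfin : S.Finite := (((Set.finite_singleton _).insert _).insert _).insert _
  have hS4 : S.ncard ≤ 4 := by
    rw [hS]
    refine (Set.ncard_insert_le _ _).trans ?_
    refine (Nat.add_le_add_right (Set.ncard_insert_le _ _) 1).trans ?_
    refine (Nat.add_le_add_right (Nat.add_le_add_right (Set.ncard_insert_le _ _) 1) 1).trans ?_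
    rw [Set.ncard_singleton]
  have hsub : Set.range ψ ⊆ Additive.ofMul '' S := by
    rintro _ ⟨P, rfl⟩
    exact ⟨_, descentPair_mem P, by rw [hψ]; exact (twoDescentMap_apply h P).symm⟩
  have hTfin : (Additive.ofMul '' S).Finite := hSfin.image _
  haveI : Finite ψ.range := (hTfin.subset (by rw [AddMonoidHom.coe_range]; exact hsub)).to_subtype
  have hcard : Nat.card ψ.range ≤ 4 := by
    rw [← SetLike.coe_sort_coe, Nat.card_coe_set_eq, AddMonoidHom.coe_range]
    calc (Set.range ψ).ncard ≤ (Additive.ofMul '' S).ncard := Set.ncard_le_ncard hsub hTfin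
      _ ≤ S.ncard := Set.ncard_image_le hSfin
      _ ≤ 4 := hS4
  -- counting: `2 ^ (r + 2) ≤ 4`
  have hbound := pow_finrank_add_two_le_natCard_range ψ hker hfin₁ hfin₂ h₁ h₂ h₃ h₁₂
  have hr : (⟨1, 1, 1, -10, -10⟩ : WeierstrassCurve ℚ).mordellWeilRank = 0 := by
    have hle :
        2 ^ (Module.finrank ℤ (⟨1, 1, 1, -10, -10⟩ : WeierstrassCurve ℚ).toAffine.Point + 2) ≤
          2 ^ 2 := hbound.trans hcard
    have := (Nat.pow_le_pow_iff_right (by norm_num)).mp hle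
    unfold WeierstrassCurve.mordellWeilRank
    omega
  exact WeierstrassCurve.finite_point_of_mordellWeilRank_eq_zero _ hr

end Curve15A1

end Literature.NumberTheory.EllipticCurves

end
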